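import Mathlib.Analysis.Calculus.Deriv.Slope
import Mathlib.Analysis.Calculus.MeanValue
import Mathlib.Analysis.Complex.RealDeriv
import Mathlib.Analysis.Complex.UpperHalfPlane.Basic
import Literature.Analysis.Complex.SchwarzReflection

/-!
# Boundary monotonicity of holomorphic maps into the upper half-plane
# (route `SAWWeldingIdentification`, helper for item `WeldingSetup`, stmt-CriticalPhenomena-4504)

A conformal map preserves orientation; the form of this principle needed to pin the SIGN
`s = ±1` of the welding configurations of the route `CriticalPhenomena/SAWWeldingIdentification`
(item `WeldingSetup`) is the following boundary statement, proved here from the Schwarz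
reflection principle (tree: `Complex.differentiableOn_schwarzReflection`):

* `strictMonoOn_boundary_of_mapsTo_upperHalfPlane` — if `g` is holomorphic on `ℍ`, maps `ℍ`
  into `ℍ`, and has REAL boundary values `gb t` at the points of a real interval `(α, β)`,
  injective in `t`, then `t ↦ gb t` is strictly INCREASING on `(α, β)`. (Reflect `g` across
  `(α, β)`; if `gb` were decreasing, the mean value theorem gives a point `c` with
  `g'(c) < 0` real, and then `im g(c + iη) = η re q(η)` with `q(η) → g'(c)`, so `g` would take
  a point of `ℍ` below the real axis.)
* `false_of_boundary_Iio_pos`, `false_of_boundary_Ioi_neg` — the two impossible boundary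
  patterns used by the sign analysis: such a `g` with `g → 0` at `0` cannot map `(-∞, 0)`
  increasingly onto positive values, nor `(0, ∞)` onto negative values.

References: J. B. Conway, *Functions of One Complex Variable I*, IX.1.1 (reflection);
Ch. Pommerenke, *Boundary Behaviour of Conformal Maps* (1992), §2.3 (orientation of the boundary
correspondence).
-/

namespace Summit.CriticalPhenomena.SAWScalingLimit.Theorems

open Set Filter Topology Complex Metric
open scoped ComplexConjugate
open UpperHalfPlane (upperHalfPlaneSet)

/-- **No orientation reversal on a real diameter.** Let `G` be holomorphic on the disc
`B(x₀, r)` (`x₀` real), real-valued on the real diameter and with positive imaginary part on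
the upper half-disc. Then `t ↦ re G t` is not strictly decreasing on the diameter: otherwise the
mean value theorem yields `c` with `G'(c) < 0` real, and `im G(c + iη) = η · re q(η)` with
`q(η) → G'(c)` would be negative for small `η > 0`. [folklore] -/
theorem not_strictAntiOn_re_of_differentiableOn_ball {G : ℂ → ℂ} {x₀ r : ℝ} (hr : 0 < r)
    (hG : DifferentiableOn ℂ G (ball (x₀ : ℂ) r))
    (hreal : ∀ t : ℝ, t ∈ Ioo (x₀ - r) (x₀ + r) → (G t).im = 0)
    (hpos : ∀ z ∈ ball (x₀ : ℂ) r, 0 < z.im → 0 < (G z).im) :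
    ¬ StrictAntiOn (fun t : ℝ => (G t).re) (Ioo (x₀ - r) (x₀ + r)) := by
  intro hanti
  -- real points of the diameter lie in the disc
  have hmem : ∀ t : ℝ, t ∈ Ioo (x₀ - r) (x₀ + r) → (t : ℂ) ∈ ball (x₀ : ℂ) r := by
    intro t ht
    rw [mem_ball, dist_eq_norm, ← ofReal_sub, norm_real, Real.norm_eq_abs, abs_lt]
    constructor <;> linarith [ht.1, ht.2]
  have hGd : ∀ t : ℝ, t ∈ Ioo (x₀ - r) (x₀ + r) → HasDerivAt G (deriv G t) (t : ℂ) := fun t ht =>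
    (hG.differentiableAt (isOpen_ball.mem_nhds (hmem t ht))).hasDerivAt
  -- the real trace `γ t = re G t` and its derivative `re G' t`
  set γ : ℝ → ℝ := fun t => (G t).re with hγ
  have hγd : ∀ t : ℝ, t ∈ Ioo (x₀ - r) (x₀ + r) → HasDerivAt γ (deriv G t).re t :=
    fun t ht => (hGd t ht).real_of_complex
  -- mean value theorem on `[x₀ - r/2, x₀ + r/2]`
  set α' : ℝ := x₀ - r / 2 with hα'
  set β' : ℝ := x₀ + r / 2 with hβ'
  have hα'β' : α' < β' := by rw [hα', hβ']; linarith
  have hsub : Icc α' β' ⊆ Ioo (x₀ - r) (x₀ + r) := fun t ht =>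
    ⟨by rw [hα'] at ht; linarith [ht.1], by rw [hβ'] at ht; linarith [ht.2]⟩
  have hγc : ContinuousOn γ (Icc α' β') := fun t ht =>
    (hγd t (hsub ht)).continuousAt.continuousWithinAt
  obtain ⟨c, hc, hceq⟩ := exists_hasDerivAt_eq_slope γ (fun t => (deriv G t).re) hα'β' hγc
    (fun t ht => hγd t (hsub (Ioo_subset_Icc_self ht)))
  have hcI : c ∈ Ioo (x₀ - r) (x₀ + r) := hsub (Ioo_subset_Icc_self hc)
  have hslope_neg : (deriv G c).re < 0 := by
    rw [hceq]
    have hlt : γ β' < γ α' := hanti (hsub (left_mem_Icc.2 hα'β'.le))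
      (hsub (right_mem_Icc.2 hα'β'.le)) hα'β'
    exact div_neg_of_neg_of_pos (by linarith) (by linarith)
  -- `G' c` is real
  set d : ℂ := deriv G c with hd
  have hdim : d.im = 0 := by
    have h1 : HasDerivAt (fun s : ℝ => G s) d c := (hGd c hcI).comp_ofReal
    have h2 : HasDerivAt (fun s : ℝ => ((γ s : ℝ) : ℂ)) (((deriv G c).re : ℝ) : ℂ) c :=
      (hγd c hcI).ofReal_comp
    have heq : (fun s : ℝ => G s) =ᶠ[𝓝 c] fun s : ℝ => ((γ s : ℝ) : ℂ) := by
      filter_upwards [isOpen_Ioo.mem_nhds hcI] with s hs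
      apply Complex.ext
      · simp [hγ]
      · rw [ofReal_im]
        exact hreal s hs
    have := (h1.congr_of_eventuallyEq heq.symm).unique h2
    rw [this, ofReal_im]
  -- the difference quotients along the vertical direction
  have hslope : Tendsto (fun w : ℂ => w⁻¹ • (G ((c : ℂ) + w) - G c)) (𝓝[≠] 0) (𝓝 d) :=
    (hGd c hcI).tendsto_slope_zero
  have hη : Tendsto (fun η : ℝ => (η : ℂ) * I) (𝓝[>] (0 : ℝ)) (𝓝[≠] (0 : ℂ)) := by
    refine tendsto_nhdsWithin_iff.2 ⟨?_, ?_⟩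
    · have hcont : Continuous fun η : ℝ => (η : ℂ) * I := by fun_prop
      have := hcont.tendsto 0
      rw [ofReal_zero, zero_mul] at this
      exact this.mono_left nhdsWithin_le_nhds
    · filter_upwards [self_mem_nhdsWithin] with η hη
      have hη0 : (η : ℂ) ≠ 0 := ofReal_ne_zero.2 (ne_of_gt hη)
      exact mul_ne_zero hη0 I_ne_zero
  have hq : Tendsto (fun η : ℝ => (((η : ℂ) * I)⁻¹ • (G ((c : ℂ) + (η : ℂ) * I) - G c)).re)
      (𝓝[>] (0 : ℝ)) (𝓝 d.re) :=
    (continuous_re.tendsto d).comp (hslope.comp hη)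
  have hev1 : ∀ᶠ η : ℝ in 𝓝[>] (0 : ℝ),
      (((η : ℂ) * I)⁻¹ • (G ((c : ℂ) + (η : ℂ) * I) - G c)).re < 0 :=
    hq (Iio_mem_nhds hslope_neg)
  -- small `η` keep `c + iη` inside the disc
  have hroom : 0 < r - |c - x₀| := by
    have : |c - x₀| < r := by
      rw [abs_lt]; constructor <;> linarith [hcI.1, hcI.2]
    linarith
  have hev2 : ∀ᶠ η : ℝ in 𝓝[>] (0 : ℝ), η ∈ Ioo 0 (r - |c - x₀|) := Ioo_mem_nhdsGT hroom
  obtain ⟨η, hη1, hη2⟩ := (hev1.and hev2).exists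
  set z : ℂ := (c : ℂ) + (η : ℂ) * I with hz
  have hzim : z.im = η := by simp [hz]
  have hzball : z ∈ ball (x₀ : ℂ) r := by
    rw [mem_ball, dist_eq_norm]
    have hzsub : z - x₀ = ((c - x₀ : ℝ) : ℂ) + (η : ℂ) * I := by
      rw [hz, ofReal_sub]; ring
    rw [hzsub]
    calc ‖((c - x₀ : ℝ) : ℂ) + (η : ℂ) * I‖ ≤ ‖((c - x₀ : ℝ) : ℂ)‖ + ‖(η : ℂ) * I‖ :=
          norm_add_le _ _
      _ = |c - x₀| + η := by
          rw [norm_real, Real.norm_eq_abs, norm_mul, norm_I, mul_one, norm_real,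
            Real.norm_eq_abs, abs_of_pos hη2.1]
      _ < r := by linarith [hη2.2]
  have hGz : 0 < (G z).im := hpos z hzball (by rw [hzim]; exact hη2.1)
  -- but `im G z = η · re q(η) < 0`
  set q : ℂ := ((η : ℂ) * I)⁻¹ • (G z - G c) with hqdef
  have hηI : (η : ℂ) * I ≠ 0 := mul_ne_zero (ofReal_ne_zero.2 hη2.1.ne') I_ne_zero
  have hGzq : G z = G c + (η : ℂ) * I * q := by
    rw [hqdef, smul_eq_mul, ← mul_assoc, mul_inv_cancel₀ hηI, one_mul]
    ring
  have him : (G z).im = η * q.re := by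
    rw [hGzq, add_im, hreal c hcI, zero_add, mul_im, mul_re, mul_im, ofReal_re, ofReal_im,
      I_re, I_im]
    ring
  have hqre : q.re < 0 := hη1
  have : (G z).im < 0 := by
    rw [him]
    exact mul_neg_of_pos_of_neg hη2.1 hqre
  exact absurd hGz (not_lt.2 this.le)

/-- **Boundary values of a holomorphic map `ℍ → ℍ` increase along the real axis.** Let `g` be
holomorphic on `ℍ` with `g(ℍ) ⊆ ℍ`, and suppose that at every point `t` of a real interval
`(α, β)` it has a real boundary value `gb t` (`g → gb t` within `ℍ`), injective in `t`. Then
`gb` is strictly increasing on `(α, β)`. Proof: `gb` is continuous (it is the trace of the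
continuous extension `extendFrom ℍ g`), hence strictly monotone or antitone
(`ContinuousOn.strictMonoOn_of_injOn_Ioo`); the Schwarz reflection of the extension across
`(α, β)` is holomorphic on the disc with diameter `(α, β)`
(`Complex.differentiableOn_schwarzReflection`), and
`not_strictAntiOn_re_of_differentiableOn_ball` excludes the antitone case. This is the
orientation-preserving character of conformal maps at a free boundary arc (Pommerenke 1992,
§2.3). [folklore] -/
theorem strictMonoOn_boundary_of_mapsTo_upperHalfPlane {g : ℂ → ℂ} {gb : ℝ → ℝ} {α β : ℝ}
    (hαβ : α < β) (hg : DifferentiableOn ℂ g upperHalfPlaneSet)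
    (hmaps : MapsTo g upperHalfPlaneSet upperHalfPlaneSet)
    (hlim : ∀ t ∈ Ioo α β, Tendsto g (𝓝[upperHalfPlaneSet] (t : ℂ)) (𝓝 ((gb t : ℝ) : ℂ)))
    (hinj : InjOn gb (Ioo α β)) : StrictMonoOn gb (Ioo α β) := by
  set G : ℂ → ℂ := extendFrom upperHalfPlaneSet g with hGdef
  set x₀ : ℝ := (α + β) / 2 with hx₀
  set ρ : ℝ := (β - α) / 2 with hρ
  have hρpos : 0 < ρ := by rw [hρ]; linarith
  have hIoo : Ioo (x₀ - ρ) (x₀ + ρ) = Ioo α β := by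
    rw [hx₀, hρ]; congr 1 <;> ring
  -- values of the extension
  have hGg : ∀ z ∈ upperHalfPlaneSet, G z = g z := fun z hz =>
    extendFrom_extends hg.continuousOn z hz
  have hcl : closure upperHalfPlaneSet = {z : ℂ | 0 ≤ z.im} := closure_setOf_lt_im 0
  have hGb : ∀ t ∈ Ioo α β, G t = ((gb t : ℝ) : ℂ) := fun t ht =>
    extendFrom_eq (by rw [hcl]; simp) (hlim t ht)
  -- real points of the disc `B(x₀, ρ)` have real part in `(α, β)`
  have hre_mem : ∀ z ∈ ball (x₀ : ℂ) ρ, z.im = 0 → z.re ∈ Ioo α β := by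
    intro z hz hzim
    have h1 : |z.re - x₀| ≤ dist z x₀ := by
      have := abs_re_le_norm (z - x₀)
      rwa [sub_re, ofReal_re, ← dist_eq_norm] at this
    have h2 : dist z (x₀ : ℂ) < ρ := mem_ball.1 hz
    have h3 : |z.re - x₀| < ρ := h1.trans_lt h2
    rw [abs_lt, hx₀, hρ] at h3
    constructor <;> linarith [h3.1, h3.2]
  -- continuity of the extension on the closed upper half-disc
  have hGc : ContinuousOn G (ball (x₀ : ℂ) ρ ∩ {z : ℂ | 0 ≤ z.im}) := by
    refine continuousOn_extendFrom (fun z hz => by rw [hcl]; exact hz.2) ?_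
    rintro z ⟨hzball, hzim⟩
    have hzim' : 0 ≤ z.im := hzim
    rcases hzim'.lt_or_eq with hpos | hzero
    · exact ⟨g z, hg.continuousOn z hpos⟩
    · have hzre : z = ((z.re : ℝ) : ℂ) := Complex.ext (by simp) (by rw [ofReal_im]; exact hzero.symm)
      refine ⟨((gb z.re : ℝ) : ℂ), ?_⟩
      have h := hlim z.re (hre_mem z hzball hzero.symm)
      rwa [← hzre] at h
  -- continuity of `gb` on `(α, β)`
  have hgbc : ContinuousOn gb (Ioo α β) := by
    have h1 : ContinuousOn (fun t : ℝ => (G t).re) (Ioo α β) := by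
      refine continuous_re.comp_continuousOn (hGc.comp continuous_ofReal.continuousOn ?_)
      intro t ht
      refine ⟨?_, by simp⟩
      rw [mem_ball, dist_eq_norm, ← ofReal_sub, norm_real, Real.norm_eq_abs, abs_lt, hx₀, hρ]
      constructor <;> linarith [ht.1, ht.2]
    refine h1.congr fun t ht => ?_
    show gb t = (G t).re
    rw [hGb t ht, ofReal_re]
  rcases hgbc.strictMonoOn_of_injOn_Ioo hαβ hinj with hmono | hanti
  · exact hmono
  exfalso
  -- Schwarz reflection across the diameter
  have hsymm : ∀ z ∈ ball (x₀ : ℂ) ρ, conj z ∈ ball (x₀ : ℂ) ρ := by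
    intro z hz
    rw [mem_ball, dist_eq_norm] at hz ⊢
    have : conj z - (x₀ : ℂ) = conj (z - x₀) := by rw [map_sub, conj_ofReal]
    rwa [this, norm_conj]
  have hGd : DifferentiableOn ℂ G (ball (x₀ : ℂ) ρ ∩ {z : ℂ | 0 < z.im}) :=
    (hg.mono fun z hz => hz.2).congr fun z hz => hGg z hz.2
  have hGreal : ∀ z ∈ ball (x₀ : ℂ) ρ, z.im = 0 → conj (G z) = G z := by
    intro z hz hzim
    have hzre : z = ((z.re : ℝ) : ℂ) := Complex.ext (by simp) (by rw [ofReal_im]; exact hzim)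
    rw [hzre, hGb z.re (hre_mem z hz hzim), conj_ofReal]
  have hR : DifferentiableOn ℂ (schwarzReflection G) (ball (x₀ : ℂ) ρ) :=
    differentiableOn_schwarzReflection isOpen_ball hsymm hGc hGd hGreal
  refine not_strictAntiOn_re_of_differentiableOn_ball hρpos hR ?_ ?_ ?_
  · intro t ht
    rw [hIoo] at ht
    rw [schwarzReflection_ofReal, hGb t ht, ofReal_im]
  · intro z hz hzim
    rw [schwarzReflection_of_nonneg hzim.le, hGg z hzim]
    exact hmaps hzim
  · rw [hIoo]
    intro a ha b hb hab
    simp only [schwarzReflection_ofReal]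
    rw [hGb a ha, hGb b hb, ofReal_re, ofReal_re]
    exact hanti ha hb hab

/-- **First impossible boundary pattern.** A holomorphic `g : ℍ → ℍ` with boundary value `0` at
`0` and real boundary values `gb t > 0` at all `t < 0`, injective in `t`, does not exist: by
`strictMonoOn_boundary_of_mapsTo_upperHalfPlane` `gb` increases on `(-∞, 0)`, while
`gb t → gb 0 = 0 < gb (-1)` as `t → 0⁻`. (Used to exclude the wrong sign of a normalised
uniformiser of a bank.) [folklore] -/
theorem false_of_boundary_Iio_pos {g : ℂ → ℂ} {gb : ℝ → ℝ}
    (hg : DifferentiableOn ℂ g upperHalfPlaneSet)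
    (hmaps : MapsTo g upperHalfPlaneSet upperHalfPlaneSet)
    (hlim : ∀ t : ℝ, t ≤ 0 → Tendsto g (𝓝[upperHalfPlaneSet] (t : ℂ)) (𝓝 ((gb t : ℝ) : ℂ)))
    (h0 : gb 0 = 0) (hinj : InjOn gb (Iio 0)) (hpos : ∀ t : ℝ, t < 0 → 0 < gb t) : False := by
  -- monotonicity on `(-∞, 0)`
  have hmono : StrictMonoOn gb (Iio 0) := by
    intro a ha b hb hab
    have hI : StrictMonoOn gb (Ioo (a - 1) 0) :=
      strictMonoOn_boundary_of_mapsTo_upperHalfPlane (by linarith [show a < 0 from ha]) hg hmaps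
        (fun t ht => hlim t ht.2.le) (hinj.mono fun t ht => ht.2)
    exact hI ⟨by linarith, ha⟩ ⟨by linarith, hb⟩ hab
  -- continuity of `gb` at `0` from the left
  set G : ℂ → ℂ := extendFrom upperHalfPlaneSet g with hGdef
  have hcl : closure upperHalfPlaneSet = {z : ℂ | 0 ≤ z.im} := closure_setOf_lt_im 0
  have hGb : ∀ t : ℝ, t ≤ 0 → G t = ((gb t : ℝ) : ℂ) := fun t ht =>
    extendFrom_eq (by rw [hcl]; simp) (hlim t ht)
  set B : Set ℂ := (fun t : ℝ => (t : ℂ)) '' Iic 0 with hB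
  have hGc : ContinuousOn G B := by
    refine continuousOn_extendFrom ?_ ?_
    · rintro _ ⟨t, -, rfl⟩
      rw [hcl]; simp
    · rintro _ ⟨t, ht, rfl⟩
      exact ⟨_, hlim t ht⟩
  have hgbc : ContinuousOn gb (Iic 0) := by
    have h1 : ContinuousOn (fun t : ℝ => (G t).re) (Iic 0) :=
      continuous_re.comp_continuousOn
        (hGc.comp continuous_ofReal.continuousOn fun t ht => ⟨t, ht, rfl⟩)
    exact h1.congr fun t ht => by show gb t = (G t).re; rw [hGb t ht, ofReal_re]
  have h1 : 0 < gb (-1) := hpos (-1) (by norm_num)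
  have hcont0 : ContinuousWithinAt gb (Iic 0) 0 := hgbc 0 (Set.mem_Iic.2 (le_refl (0 : ℝ)))
  have hev : ∀ᶠ t in 𝓝[Iic (0 : ℝ)] 0, gb t < gb (-1) := by
    have := hcont0.tendsto
    rw [h0] at this
    exact this (Iio_mem_nhds h1)
  have hev2 : ∀ᶠ t in 𝓝[Iic (0 : ℝ)] 0, t ∈ Ioo (-1 : ℝ) 1 :=
    mem_nhdsWithin_of_mem_nhds (Ioo_mem_nhds (by norm_num) (by norm_num))
  have hev3 : ∀ᶠ t in 𝓝[Iic (0 : ℝ)] 0, t ∈ Iic (0 : ℝ) := self_mem_nhdsWithin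
  -- a point `t ∈ (-1, 0)` close to `0`
  have hne : (𝓝[Iio (0 : ℝ)] 0).NeBot := inferInstance
  have hle : 𝓝[Iio (0 : ℝ)] 0 ≤ 𝓝[Iic (0 : ℝ)] 0 := nhdsWithin_mono 0 Iio_subset_Iic_self
  obtain ⟨t, ⟨ht1, ht2⟩, ht3⟩ :=
    (((hev.and hev2).filter_mono hle).and (self_mem_nhdsWithin (s := Iio (0 : ℝ)) (a := 0))).exists
  have hlt : gb (-1) < gb t := hmono (show (-1 : ℝ) < 0 by norm_num) ht3 ht2.1
  exact absurd ht1 (not_lt.2 hlt.le)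

/-- **Second impossible boundary pattern.** A holomorphic `g : ℍ → ℍ` with boundary value `0`
at `0` and real boundary values `gb t < 0` at all `t > 0`, injective in `t`, does not exist:
`gb` increases on `(0, ∞)` while `gb t → 0 > gb 1` as `t → 0⁺`. [folklore] -/
theorem false_of_boundary_Ioi_neg {g : ℂ → ℂ} {gb : ℝ → ℝ}
    (hg : DifferentiableOn ℂ g upperHalfPlaneSet)
    (hmaps : MapsTo g upperHalfPlaneSet upperHalfPlaneSet)
    (hlim : ∀ t : ℝ, 0 ≤ t → Tendsto g (𝓝[upperHalfPlaneSet] (t : ℂ)) (𝓝 ((gb t : ℝ) : ℂ)))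
    (h0 : gb 0 = 0) (hinj : InjOn gb (Ioi 0)) (hneg : ∀ t : ℝ, 0 < t → gb t < 0) : False := by
  have hmono : StrictMonoOn gb (Ioi 0) := by
    intro a ha b hb hab
    have hI : StrictMonoOn gb (Ioo 0 (b + 1)) :=
      strictMonoOn_boundary_of_mapsTo_upperHalfPlane (by linarith [show 0 < b from hb]) hg hmaps
        (fun t ht => hlim t ht.1.le) (hinj.mono fun t ht => ht.1)
    exact hI ⟨ha, by linarith⟩ ⟨hb, by linarith⟩ hab
  set G : ℂ → ℂ := extendFrom upperHalfPlaneSet g with hGdef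
  have hcl : closure upperHalfPlaneSet = {z : ℂ | 0 ≤ z.im} := closure_setOf_lt_im 0
  have hGb : ∀ t : ℝ, 0 ≤ t → G t = ((gb t : ℝ) : ℂ) := fun t ht =>
    extendFrom_eq (by rw [hcl]; simp) (hlim t ht)
  set B : Set ℂ := (fun t : ℝ => (t : ℂ)) '' Ici 0 with hB
  have hGc : ContinuousOn G B := by
    refine continuousOn_extendFrom ?_ ?_
    · rintro _ ⟨t, -, rfl⟩
      rw [hcl]; simp
    · rintro _ ⟨t, ht, rfl⟩
      exact ⟨_, hlim t ht⟩
  have hgbc : ContinuousOn gb (Ici 0) := by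
    have h1 : ContinuousOn (fun t : ℝ => (G t).re) (Ici 0) :=
      continuous_re.comp_continuousOn
        (hGc.comp continuous_ofReal.continuousOn fun t ht => ⟨t, ht, rfl⟩)
    exact h1.congr fun t ht => by show gb t = (G t).re; rw [hGb t ht, ofReal_re]
  have h1 : gb 1 < 0 := hneg 1 (by norm_num)
  have hcont0 : ContinuousWithinAt gb (Ici 0) 0 := hgbc 0 (Set.mem_Ici.2 (le_refl (0 : ℝ)))
  have hev : ∀ᶠ t in 𝓝[Ici (0 : ℝ)] 0, gb 1 < gb t := by
    have := hcont0.tendsto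
    rw [h0] at this
    exact this (Ioi_mem_nhds h1)
  have hev2 : ∀ᶠ t in 𝓝[Ici (0 : ℝ)] 0, t ∈ Ioo (-1 : ℝ) 1 :=
    mem_nhdsWithin_of_mem_nhds (Ioo_mem_nhds (by norm_num) (by norm_num))
  have hle : 𝓝[Ioi (0 : ℝ)] 0 ≤ 𝓝[Ici (0 : ℝ)] 0 := nhdsWithin_mono 0 Ioi_subset_Ici_self
  obtain ⟨t, ⟨ht1, ht2⟩, ht3⟩ :=
    (((hev.and hev2).filter_mono hle).and (self_mem_nhdsWithin (s := Ioi (0 : ℝ)) (a := 0))).exists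
  have hlt : gb t < gb 1 := hmono ht3 (show (0 : ℝ) < 1 by norm_num) ht2.2
  exact absurd ht1 (not_lt.2 hlt.le)

end Summit.CriticalPhenomena.SAWScalingLimit.Theorems
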